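import Summits.HubbardSuperconductivity.HubbardSuperconductivity.Theorems.LogColdTorusLogColdDWaveOrderSectorPairDecay
import Summits.HubbardSuperconductivity.HubbardSuperconductivity.Theorems.WidthHaldaneTubeSectorPartitionBlock
import HarnessLib

/-!
# `KkBandLift` (crux stmt-HubbardSuperconductivity-10402, route `KkFloor`) — negative side, N4:
# Koma–Tasaki pair decay in the CANONICAL sector, in the projector vocabulary of the skeleton

Refuter file (B2b-4 gen 2; HONEST FRAMING: the value here is a THEOREM — the last physics stub of
the strategist's negation skeleton `Cruxes/KkBandLift/StrategistNegation.lean` discharged by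
EXTRACTION from results already in the tree — not summit progress; the verdict `¬ KkBandLift` is
already landed, `Theorems/KkFloorKkBandLiftRefutation.lean`).

The skeleton's N4 `SectorPairDecay` speaks the sector Gibbs average
`⟨A⟩_{β,K} = tr (P_K e^{-βH} A) / tr (P_K e^{-βH})` (`P_K = projMatrix` of the transported joint
sector `K = szSector (2m) 0`, the expression of `Literature…FinDimSpectrumSectorGibbsLimit`), while
the tree's canonical-sector Koma–Tasaki bound
(`Theorems.LogColdTorus.logColdSector_pairDecay`, file
`Theorems/LogColdTorusLogColdDWaveOrderSectorPairDecay.lean`) speaks the Gibbs state of the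
COMPRESSION `H.toBlock p p` to the occupation block `p s := (#↑s = m ∧ #↓s = m)`. This file proves
the two are the same number for every sector-preserving `H` and transports the bound:

* `toBlock_compl_pow_eq_zero`, `toBlock_compl_exp_eq_zero`, `toBlock_compl_gibbsWeight_eq_zero` —
  GENERIC: a matrix with no entries from the block `p` to its complement has `(e^{A})_{p,¬p} = 0`
  (exponential series term by term; companion of
  `Theorems.WidthHaldane.toBlock_exp_of_toBlock_compl_eq_zero`, `(e^{A})_p = e^{A_p}`);
* `sectorGibbsAvg_szSector_eq_gibbsState_toBlock` — THE DICTIONARY, any `PreservesSectors H`, any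
  observable `A`, any `β`, any `m`:
  `tr (P_{(2m,0)} e^{-βH} A) / tr (P_{(2m,0)} e^{-βH}) = gibbsState β (H.toBlock p p) (A.toBlock p p)`
  (`projMatrix_szSector_two_mul_zero_eq_diagonal`, `trace_indicator_mul_eq_trace_toBlock`,
  `toBlock_gibbsWeight_of_toBlock_compl_eq_zero`, and the new off-diagonal vanishing);
* `sectorPairDecay` — the proposition `SectorPairDecay` of the skeleton VERBATIM (with the local
  abbreviation `sectorGibbsAvg` written out): for all `U`, all `β > 0` there are `C` and `f > 0`
  (`C = pairFieldDecayConst dWaveFormFactor`, `f = pairDecayExponent β`, depending on `β` only)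
  with `|⟨(P_x)† P_y⟩_{β,(2m,0)}| ≤ C (dist(x,y)+1)^{-f}` for every side `L`, every `m` and all
  sites `x, y` of the torus `(ℤ/Lℤ)²` (empty sectors `m > L²` give the junk value `0`).

Sources: T. Koma, H. Tasaki, Phys. Rev. Lett. 68 (1992) 3248 = arXiv:cond-mat/9709068, Theorem
(eq. (2)), canonical average eq. (3) ("Our result is independent of ρ and thus applies to grand
canonical averages as well"), footnote [10]; H. Tasaki, *Physics and Mathematics of Quantum
Many-Body Systems* (2020) App. A.2. No definitions.
-/

-- the mandated namespace `Summit.<Summit>.<Problem>.Theorems…` repeats `HubbardSuperconductivity`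
-- (single-problem summit, D-0017), which the `dupNamespace` linter flags on every declaration
set_option linter.dupNamespace false
-- the structural `DecidableEq {s // #↑s = m ∧ #↓s = m}` instance over `Finset (Orb (FermionTorus d L))`
-- is FOUND by the default search but its term exceeds the default `synthInstance.maxSize` (128);
-- tree idiom (`Theorems/LogColdTorusAverageToEveryBlockTrace.lean`, `ChiralWindow*.lean`)
set_option synthInstance.maxSize 512

noncomputable section

namespace Summit.HubbardSuperconductivity.HubbardSuperconductivity.Theorems.KkBandLift.Negative

open Matrix
open Literature.MathematicalPhysics.QuantumLattice Literature.Probability.LatticeModels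
  Literature.Barriers.HubbardSuperconductivity
  Summit.HubbardSuperconductivity.HubbardSuperconductivity.Theorems
  Summit.HubbardSuperconductivity.HubbardSuperconductivity.Theorems.LogColdTorus
  Summit.HubbardSuperconductivity.HubbardSuperconductivity.Theorems.WidthHaldane
open scoped ComplexOrder

/-! ### Generic: the off-diagonal block of `e^{A}` vanishes with that of `A` -/

section BlockExp

variable {ι : Type*} [Fintype ι] [DecidableEq ι]

/-- Powers of a matrix with no entries from the block `p` to its complement have none either:
`(A^k)_{p,¬p} = 0`. [folklore] -/
theorem toBlock_compl_pow_eq_zero (A : Matrix ι ι ℂ) (p : ι → Prop) [DecidablePred p]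
    (hA : A.toBlock p (fun a => ¬ p a) = 0) (k : ℕ) :
    (A ^ k).toBlock p (fun a => ¬ p a) = 0 := by
  induction k with
  | zero =>
      ext a b
      have hab : (a : ι) ≠ b := fun h => b.2 (h ▸ a.2)
      rw [pow_zero, toBlock_apply, Matrix.one_apply_ne hab, Matrix.zero_apply]
  | succ k ih =>
      rw [pow_succ', toBlock_mul_eq_add p p (fun a => ¬ p a) A (A ^ k), ih, hA,
        Matrix.mul_zero, Matrix.zero_mul, add_zero]

open NormedSpace in
open scoped Matrix.Norms.Operator in
/-- **The exponential of a matrix with no entries from the block `p` to its complement has none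
either**: `(e^{A})_{p,¬p} = 0` (the exponential series term by term,
`toBlock_compl_pow_eq_zero`). [folklore] -/
theorem toBlock_compl_exp_eq_zero (A : Matrix ι ι ℂ) (p : ι → Prop) [DecidablePred p]
    (hA : A.toBlock p (fun a => ¬ p a) = 0) :
    (exp A).toBlock p (fun a => ¬ p a) = 0 := by
  have hs := exp_series_hasSum_exp' (𝕂 := ℂ) A
  let g : Matrix ι ι ℂ →+ Matrix {a // p a} {a // ¬ p a} ℂ :=
    { toFun := fun X => X.toBlock p (fun a => ¬ p a), map_zero' := rfl,
      map_add' := fun _ _ => rfl }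
  have hg : Continuous g := continuous_id.matrix_submatrix _ _
  have h1 : HasSum (fun k => ((k.factorial : ℂ)⁻¹ • A ^ k).toBlock p (fun a => ¬ p a))
      ((exp A).toBlock p (fun a => ¬ p a)) :=
    hs.map g hg
  have heq : (fun k => ((k.factorial : ℂ)⁻¹ • A ^ k).toBlock p (fun a => ¬ p a)) =
      fun _ => 0 := by
    funext k
    ext a b
    have h := congrFun (congrFun (toBlock_compl_pow_eq_zero A p hA k) a) b
    simp only [toBlock_apply, Matrix.zero_apply] at h
    simp only [toBlock_apply, Matrix.smul_apply, h, smul_zero, Matrix.zero_apply]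
  rw [heq] at h1
  exact h1.unique hasSum_zero

/-- The Gibbs weight of a matrix with no entries from the block `p` to its complement has none
either: `(e^{-βH})_{p,¬p} = 0`. [folklore] -/
theorem toBlock_compl_gibbsWeight_eq_zero (β : ℝ) (H : Matrix ι ι ℂ) (p : ι → Prop)
    [DecidablePred p] (hH : H.toBlock p (fun a => ¬ p a) = 0) :
    (gibbsWeight β H).toBlock p (fun a => ¬ p a) = 0 := by
  have hs : (-(β : ℂ) • H).toBlock p (fun a => ¬ p a) = 0 := by
    ext a b
    have h := congrFun (congrFun hH a) b
    simp only [toBlock_apply, Matrix.zero_apply] at h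
    simp only [toBlock_apply, Matrix.smul_apply, h, smul_zero, Matrix.zero_apply]
  rw [gibbsWeight]
  exact toBlock_compl_exp_eq_zero _ p hs

end BlockExp

/-! ### The dictionary: sector Gibbs average (projector form) = Gibbs state of the compression -/

section Dictionary

variable {Λ : Type*} [LinearOrder Λ] [Fintype Λ]

/-- A sector-preserving matrix has no entries from the occupation block `(#↑ = m, #↓ = m)` to its
complement. [cite: LiebPRL1989, Remark (2)] -/
theorem toBlock_sector_compl_eq_zero_of_preservesSectors
    {H : Matrix (Finset (Orb Λ)) (Finset (Orb Λ)) ℂ} (hH : PreservesSectors H) (m : ℕ) :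
    H.toBlock (fun s : Finset (Orb Λ) => (upPart s).card = m ∧ (downPart s).card = m)
        (fun s : Finset (Orb Λ) => ¬ ((upPart s).card = m ∧ (downPart s).card = m)) = 0 := by
  ext a b
  rw [toBlock_apply, Matrix.zero_apply]
  by_contra h
  have hs := hH a.1 b.1 h
  exact b.2 ⟨hs.1.symm.trans a.2.1, hs.2.symm.trans a.2.2⟩

/-- **THE DICTIONARY.** For every sector-preserving `H` (`PreservesSectors`: block diagonal in
`(N↑, N↓)`), every observable `A`, every `β` and every `m`, the sector Gibbs average of the
skeleton / of `FinDimSpectrumSectorGibbsLimit` on the joint sector `(N, S^z) = (2m, 0)`,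
`tr (P_{(2m,0)} e^{-βH} A) / tr (P_{(2m,0)} e^{-βH})`, EQUALS the Gibbs state of the compression
`H.toBlock p p` evaluated on `A.toBlock p p`, `p s := (#↑s = m ∧ #↓s = m)` — the functional of
`Theorems.LogColdTorus.logColdSector_pairDecay`. (`P_{(2m,0)} = diag 𝟙_p`,
`tr (diag 𝟙_p X) = tr X_p`, `(e^{-βH} A)_p = (e^{-βH})_p A_p` because `(e^{-βH})_{p,¬p} = 0`, and
`(e^{-βH})_p = e^{-βH_p}`.) Koma–Tasaki's eq. (3). [cite: KomaTasakiPRL1992, eq. (3)] -/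
theorem sectorGibbsAvg_szSector_eq_gibbsState_toBlock
    (H A : Matrix (Finset (Orb Λ)) (Finset (Orb Λ)) ℂ) (hH : PreservesSectors H) (β : ℝ) (m : ℕ) :
    (projMatrix ((szSector (Λ := Λ) (2 * m) 0).map
          ((WithLp.linearEquiv 2 ℂ (Finset (Orb Λ) → ℂ)).symm :
            (Finset (Orb Λ) → ℂ) →ₗ[ℂ] EuclideanSpace ℂ (Finset (Orb Λ)))) *
        gibbsWeight β H * A).trace /
      (projMatrix ((szSector (Λ := Λ) (2 * m) 0).map
          ((WithLp.linearEquiv 2 ℂ (Finset (Orb Λ) → ℂ)).symm :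
            (Finset (Orb Λ) → ℂ) →ₗ[ℂ] EuclideanSpace ℂ (Finset (Orb Λ)))) *
        gibbsWeight β H).trace =
    gibbsState β
      (H.toBlock (fun s : Finset (Orb Λ) => (upPart s).card = m ∧ (downPart s).card = m)
        (fun s : Finset (Orb Λ) => (upPart s).card = m ∧ (downPart s).card = m))
      (A.toBlock (fun s : Finset (Orb Λ) => (upPart s).card = m ∧ (downPart s).card = m)
        (fun s : Finset (Orb Λ) => (upPart s).card = m ∧ (downPart s).card = m)) := by
  have hP : projMatrix ((szSector (Λ := Λ) (2 * m) 0).map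
          ((WithLp.linearEquiv 2 ℂ (Finset (Orb Λ) → ℂ)).symm :
            (Finset (Orb Λ) → ℂ) →ₗ[ℂ] EuclideanSpace ℂ (Finset (Orb Λ)))) =
      diagonal fun s : Finset (Orb Λ) =>
        if (upPart s).card = m ∧ (downPart s).card = m then (1 : ℂ) else 0 :=
    projMatrix_szSector_two_mul_zero_eq_diagonal (Λ := Λ) m
  have hHc := toBlock_sector_compl_eq_zero_of_preservesSectors hH m
  rw [hP, Matrix.mul_assoc,
    trace_indicator_mul_eq_trace_toBlock
      (fun s : Finset (Orb Λ) => (upPart s).card = m ∧ (downPart s).card = m)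
      (gibbsWeight β H * A),
    trace_indicator_mul_eq_trace_toBlock
      (fun s : Finset (Orb Λ) => (upPart s).card = m ∧ (downPart s).card = m)
      (gibbsWeight β H),
    toBlock_mul_eq_add (fun s : Finset (Orb Λ) => (upPart s).card = m ∧ (downPart s).card = m)
      (fun s : Finset (Orb Λ) => (upPart s).card = m ∧ (downPart s).card = m)
      (fun s : Finset (Orb Λ) => (upPart s).card = m ∧ (downPart s).card = m)
      (gibbsWeight β H) A,
    toBlock_compl_gibbsWeight_eq_zero β H _ hHc, Matrix.zero_mul, add_zero,
    toBlock_gibbsWeight_of_toBlock_compl_eq_zero β H _ hHc, gibbsState_apply, partitionFn,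
    div_eq_inv_mul]

/-- **The dictionary at the Hubbard torus** (instances synthesised at the torus, as in the
skeleton's `SectorPairDecay` and the route's declarations; `H = hubbardTorus d L t U` preserves the
sectors, `preservesSectors_hubbardTorus`): for every observable `A`, every `β` and every `m`,
`tr (P_{(2m,0)} e^{-βH} A) / tr (P_{(2m,0)} e^{-βH}) = gibbsState β (H.toBlock p p) (A.toBlock p p)`,
`p s := (#↑s = m ∧ #↓s = m)`. [cite: KomaTasakiPRL1992, eq. (3)] -/
theorem sectorGibbsAvg_szSector_hubbardTorus_eq_gibbsState_toBlock (d L : ℕ) (t U β : ℝ) (m : ℕ)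
    (A : Matrix (Finset (Orb (FermionTorus d L))) (Finset (Orb (FermionTorus d L))) ℂ) :
    (projMatrix ((szSector (Λ := FermionTorus d L) (2 * m) 0).map
          ((WithLp.linearEquiv 2 ℂ (Finset (Orb (FermionTorus d L)) → ℂ)).symm :
            (Finset (Orb (FermionTorus d L)) → ℂ) →ₗ[ℂ]
              EuclideanSpace ℂ (Finset (Orb (FermionTorus d L))))) *
        gibbsWeight β (hubbardTorus d L t U) * A).trace /
      (projMatrix ((szSector (Λ := FermionTorus d L) (2 * m) 0).map
          ((WithLp.linearEquiv 2 ℂ (Finset (Orb (FermionTorus d L)) → ℂ)).symm :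
            (Finset (Orb (FermionTorus d L)) → ℂ) →ₗ[ℂ]
              EuclideanSpace ℂ (Finset (Orb (FermionTorus d L))))) *
        gibbsWeight β (hubbardTorus d L t U)).trace =
    gibbsState β
      ((hubbardTorus d L t U).toBlock
        (fun s : Finset (Orb (FermionTorus d L)) => (upPart s).card = m ∧ (downPart s).card = m)
        (fun s : Finset (Orb (FermionTorus d L)) => (upPart s).card = m ∧ (downPart s).card = m))
      (A.toBlock
        (fun s : Finset (Orb (FermionTorus d L)) => (upPart s).card = m ∧ (downPart s).card = m)
        (fun s : Finset (Orb (FermionTorus d L)) =>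
          (upPart s).card = m ∧ (downPart s).card = m)) := by
  have hP : projMatrix ((szSector (Λ := FermionTorus d L) (2 * m) 0).map
          ((WithLp.linearEquiv 2 ℂ (Finset (Orb (FermionTorus d L)) → ℂ)).symm :
            (Finset (Orb (FermionTorus d L)) → ℂ) →ₗ[ℂ]
              EuclideanSpace ℂ (Finset (Orb (FermionTorus d L))))) =
      diagonal fun s : Finset (Orb (FermionTorus d L)) =>
        if (upPart s).card = m ∧ (downPart s).card = m then (1 : ℂ) else 0 :=
    projMatrix_szSector_fermionTorus_eq_diagonal d L m
  have hHc := toBlock_sector_compl_eq_zero_of_preservesSectors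
    (preservesSectors_hubbardTorus d L t U) m
  rw [hP, Matrix.mul_assoc,
    trace_indicator_mul_eq_trace_toBlock
      (fun s : Finset (Orb (FermionTorus d L)) => (upPart s).card = m ∧ (downPart s).card = m)
      (gibbsWeight β (hubbardTorus d L t U) * A),
    trace_indicator_mul_eq_trace_toBlock
      (fun s : Finset (Orb (FermionTorus d L)) => (upPart s).card = m ∧ (downPart s).card = m)
      (gibbsWeight β (hubbardTorus d L t U)),
    toBlock_mul_eq_add
      (fun s : Finset (Orb (FermionTorus d L)) => (upPart s).card = m ∧ (downPart s).card = m)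
      (fun s : Finset (Orb (FermionTorus d L)) => (upPart s).card = m ∧ (downPart s).card = m)
      (fun s : Finset (Orb (FermionTorus d L)) => (upPart s).card = m ∧ (downPart s).card = m)
      (gibbsWeight β (hubbardTorus d L t U)) A,
    toBlock_compl_gibbsWeight_eq_zero β _ _ hHc, Matrix.zero_mul, add_zero,
    toBlock_gibbsWeight_of_toBlock_compl_eq_zero β _ _ hHc, gibbsState_apply, partitionFn,
    div_eq_inv_mul]

end Dictionary

/-! ### N4 `SectorPairDecay` of the skeleton -/

section Torus

/-- **N4 `SectorPairDecay`** of `Cruxes/KkBandLift/StrategistNegation.lean`, VERBATIM with the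
local abbreviation `sectorGibbsAvg H K β A = tr (P_K e^{-βH} A) / tr (P_K e^{-βH})` written out —
Koma–Tasaki's power-law bound for the summit's `d`-wave local pair field in the CANONICAL
`(N, S^z) = (2m, 0)` sectors of the pure torus `hubbardTorus 2 L 1 U`, uniformly in `L` and `m`:
for all `U`, all `β > 0` there are `C` (`= pairFieldDecayConst dWaveFormFactor = 32e²`) and
`f > 0` (`= pairDecayExponent β`, depending on `β` only) with
`|⟨(P_x)ᴴ P_y⟩_{β,(2m,0)}| ≤ C (dist(x,y)+1)^{-f}` for every side `L`, every `m` and all sites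
(EXTRACTION: the dictionary `sectorGibbsAvg_szSector_eq_gibbsState_toBlock` applied to the tree's
`Theorems.LogColdTorus.logColdSector_pairDecay`; an empty sector, `m > L²`, gives the junk value
`0 ≤ C (dist+1)^{-f}`). [cite: KomaTasakiPRL1992, Theorem eq. (2), eq. (3) and footnote [10]] -/
theorem sectorPairDecay :
    ∀ (U β : ℝ), 0 < β → ∃ C f : ℝ, 0 < f ∧ ∀ (L : ℕ) [NeZero L] (m : ℕ) (x y : TorusSite 2 L),
      ‖(projMatrix ((szSector (Λ := FermionTorus 2 L) (2 * m) 0).map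
            ((WithLp.linearEquiv 2 ℂ (Finset (Orb (FermionTorus 2 L)) → ℂ)).symm :
              (Finset (Orb (FermionTorus 2 L)) → ℂ) →ₗ[ℂ]
                EuclideanSpace ℂ (Finset (Orb (FermionTorus 2 L))))) *
            gibbsWeight β (hubbardTorus 2 L 1 U) *
            ((localPair dWaveFormFactor L x)ᴴ * localPair dWaveFormFactor L y)).trace /
          (projMatrix ((szSector (Λ := FermionTorus 2 L) (2 * m) 0).map
            ((WithLp.linearEquiv 2 ℂ (Finset (Orb (FermionTorus 2 L)) → ℂ)).symm :
              (Finset (Orb (FermionTorus 2 L)) → ℂ) →ₗ[ℂ]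
                EuclideanSpace ℂ (Finset (Orb (FermionTorus 2 L))))) *
            gibbsWeight β (hubbardTorus 2 L 1 U)).trace‖ ≤
        C * ((torusDist x y : ℝ) + 1) ^ (-f) := by
  intro U β hβ
  refine ⟨pairFieldDecayConst dWaveFormFactor, pairDecayExponent (β * |(1 : ℝ)|),
    pairDecayExponent_pos (by positivity), ?_⟩
  intro L _ m x y
  rw [sectorGibbsAvg_szSector_hubbardTorus_eq_gibbsState_toBlock 2 L 1 U β m]
  by_cases hne : Nonempty {s : Finset (Orb (FermionTorus 2 L)) //
      (upPart s).card = m ∧ (downPart s).card = m}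
  · haveI := hne
    exact norm_gibbsState_toBlock_hubbardTorus_localPairCorr_le dWaveFormFactor 1 U hβ.le
      (fun s : Finset (Orb (FermionTorus 2 L)) => (upPart s).card = m ∧ (downPart s).card = m) x y
  · haveI : IsEmpty {s : Finset (Orb (FermionTorus 2 L)) //
        (upPart s).card = m ∧ (downPart s).card = m} := not_nonempty_iff.mp hne
    rw [gibbsState_apply, Matrix.trace, Fintype.sum_empty, mul_zero, norm_zero]
    exact mul_nonneg (pairFieldDecayConst_nonneg _) (Real.rpow_nonneg (by positivity) _)

end Torus

end Summit.HubbardSuperconductivity.HubbardSuperconductivity.Theorems.KkBandLift.Negative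

end
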